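import Summits.QuantumFields.YangMills.Theorems.BalabanLadderIRTwistedSlabBoxAnchor
import Literature.NumberTheory.DiophantineApproximation.GeneralizedPolynomialsUDSufficiency
import HarnessLib

/-!
# T1 AT TREE LEVEL, UNIFORMLY IN `L` AND `t`: `lim_{β→∞} projSlabDefect(β; ℓ₀, L, t) ≤ C(N,ℓ₀)·L·e^{−c(N,ℓ₀)·t}` for the twisted `SU(N)` slab

HELPER toward stub **T1** `TwistedSlabAnchor` of LINE `twisted-slab-continuity` (crux `IRcof`, stmt-QuantumFields-26930, census row 43;
LEAD prover ym-ir-line-tsc-p1 g5; `--supports` the crux, `--as helper`).  Theorems only.  K36 of the T1 programme: T1 asks for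
`projSlabDefect ≤ C·L·e^{−ct}` with `(ℓ₀, β₀, c, C)` chosen BEFORE `L, t` and all `β ≥ β₀`.  K31d proved the conclusion box by box
(`∀ L ∃ β₀ c C`).  Here the complementary statement: the CLASSICAL LIMIT (`β → ∞`, THE NUMBER `1 − ∏_{p,q} tanh²(tω_{p,q}∕2)`, K31d
`tendsto_projSlabDefect_tanh`) obeys T1's bound with constants `c = min_{p,q₀,q₁} ω⊥ > 0` and `C = 4·(N²−1)·ℓ₀²` that do NOT depend on `L` or `t`:
* `one_sub_tanh_sq_le` (`1 − tanh² y ≤ 4e^{−2y}`, `y ≥ 0`; the union bound `1 − ∏ xᵢ ≤ Σ (1 − xᵢ)` is the tree's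
  `Literature.NumberTheory.DiophantineApproximation.HalandUD.one_sub_prod_le_sum`);
* `ladderFreq_ge_transverse` — the frequency of a mode only GROWS with its momentum along the long direction `2`: `ω_{p,(q₀,q₁,q₂)}(ℓ₀,ℓ₀,L) ≥
  ω_{p,(q₀,q₁,0)}(ℓ₀,ℓ₀,1) =: ω⊥_{p,q₀,q₁}` (the twisted transverse gap does not see `L`);
* ★★★ `twistedSlabAnchor_treeLevel_uniform` — for `N ≥ 2`, `k` a unit, `z^n = 1`, `n ≥ 1`, and every transverse size `ℓ₀ = m+1`: `∃ c > 0, C ≥ 0` (depending on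
  `N, m` only) such that for ALL `L = m₂+1`, `t = m₃+1` the tree-level defect `D_∞(L, t) := lim_β projSlabDefect(fund; β, z, n, ℓ₀, L, t)` exists and
  `D_∞(L, t) ≤ C·L·e^{−ct}` — the SHAPE of T1 (`C·L·e^{−ct}`: one-dimensional multiplicity `L` of the slab's excitations, tree-level gap `c ≍ 1∕(Nℓ₀)`)
  is exactly right at `β = ∞`, uniformly.

HONEST FRAMING: a statement about the `β → ∞` LIMIT at each box (the limit is taken before `L, t` vary); T1 needs the bound at FINITE `β ≥ β₀` with `β₀`
independent of `L` — the interchange `β → ∞` ∕ `L → ∞` (M4, cluster expansion) is NOT addressed; T1 0∕1; IRcof ∕ IR 0∕1; the Yang–Mills mass gap (Clay) is NOT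
proved; R4 = `BalabanLadder.UV` only.  References: G. 't Hooft, NPB 153 (1979) §5; M. García Pérez, A. González-Arroyo, M. Okawa, IJMPA 29 (2014) 1445001 §3.
-/

set_option autoImplicit false

noncomputable section

open scoped BigOperators Topology
open Finset Filter
open Literature.MathematicalPhysics.QuantumFieldTheory Literature.MathematicalPhysics.QuantumLattice
open Literature.Combinatorics.SimpleGraph (cycleAngle)

namespace Summit.QuantumFields.YangMills.Cruxes.IRcof.TwistedSlab

/-! ## §1 An elementary inequality -/

/-- `1 − tanh² y ≤ 4e^{−2y}` for `y ≥ 0` (`1 − tanh² = 1∕cosh²`, `cosh y ≥ e^y∕2`). [folklore] -/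
theorem one_sub_tanh_sq_le {y : ℝ} (hy : 0 ≤ y) : 1 - Real.tanh y ^ 2 ≤ 4 * Real.exp (-(2 * y)) := by
  have hc : 0 < Real.cosh y := Real.cosh_pos y
  have h1 : 1 - Real.tanh y ^ 2 = 1 / Real.cosh y ^ 2 := by
    rw [Real.tanh_eq_sinh_div_cosh, div_pow]
    have := Real.cosh_sq_sub_sinh_sq y
    field_simp
    linarith
  have h2 : Real.exp y / 2 ≤ Real.cosh y := by
    rw [Real.cosh_eq]; have := Real.exp_pos (-y); linarith
  have h3 : Real.exp y ^ 2 / 4 ≤ Real.cosh y ^ 2 := by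
    have h := pow_le_pow_left₀ (by positivity) h2 2
    calc Real.exp y ^ 2 / 4 = (Real.exp y / 2) ^ 2 := by ring
      _ ≤ Real.cosh y ^ 2 := h
  rw [h1, div_le_iff₀ (by positivity)]
  have h4 : Real.exp (-(2 * y)) * Real.exp y ^ 2 = 1 := by
    rw [← Real.exp_nat_mul, ← Real.exp_add]; norm_num
  have _ := hy
  nlinarith [h3, h4, Real.exp_pos (-(2 * y))]

/-! ## §2 The transverse gap does not see the long direction -/

variable {N : ℕ} [NeZero N]

/-- On the one-point circle every angle vanishes. [folklore] -/
theorem cycleAngle_one (q : Fin 1) : cycleAngle 1 q = 0 := by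
  have hq : q = 0 := Subsingleton.elim _ _
  subst hq
  simp [cycleAngle]

/-- **The frequency only grows with the momentum along the long direction**: for every colour momentum `p` and transverse momenta `q₀, q₁`,
`ω_{p,(q₀,q₁,q₂)}(ℓ₀,ℓ₀,m₂+1) ≥ ω_{p,(q₀,q₁,0)}(ℓ₀,ℓ₀,1)` — the direction-`2` term `2 − 2cos(2πq₂∕(m₂+1)) ≥ 0` is added under `√` and `arsinh`.
[cite: GarciaperezGonzalezarroyoOkawa2014, §3] -/
theorem ladderFreq_ge_transverse (k : ZMod N) {m m₂ : ℕ} (p : {p : Fin N × Fin N // p ≠ (0, 0)}) (q₀ q₁ : Fin (m + 1)) (q₂ : Fin (m₂ + 1)) :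
    2 * Real.arsinh (Real.sqrt
        ((2 - 2 * Real.cos (-(2 * Real.pi * (k.val : ℝ) / N) * (p.1.2 : ℕ) / (m + 1 : ℕ) + cycleAngle (m + 1) q₀)) +
          ((2 - 2 * Real.cos ((2 * Real.pi * (k.val : ℝ) / N) * (p.1.1 : ℕ) / (m + 1 : ℕ) + cycleAngle (m + 1) q₁)) +
            (2 - 2 * Real.cos (0 + cycleAngle (0 + 1) (0 : Fin (0 + 1)))))) / 2) ≤
      2 * Real.arsinh (Real.sqrt
        ((2 - 2 * Real.cos (-(2 * Real.pi * (k.val : ℝ) / N) * (p.1.2 : ℕ) / (m + 1 : ℕ) + cycleAngle (m + 1) q₀)) +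
          ((2 - 2 * Real.cos ((2 * Real.pi * (k.val : ℝ) / N) * (p.1.1 : ℕ) / (m + 1 : ℕ) + cycleAngle (m + 1) q₁)) +
            (2 - 2 * Real.cos (0 + cycleAngle (m₂ + 1) q₂)))) / 2) := by
  have h0 : 2 - 2 * Real.cos (0 + cycleAngle (0 + 1) (0 : Fin (0 + 1))) = 0 := by
    simp [cycleAngle]
  have h2 : 0 ≤ 2 - 2 * Real.cos (0 + cycleAngle (m₂ + 1) q₂) := by
    have := Real.cos_le_one (0 + cycleAngle (m₂ + 1) q₂); linarith
  rw [h0]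
  refine mul_le_mul_of_nonneg_left (Real.arsinh_le_arsinh.2 ?_) zero_le_two
  exact div_le_div_of_nonneg_right (Real.sqrt_le_sqrt (by linarith)) zero_le_two


/-! ## §3 T1 at tree level with `L`- and `t`-uniform constants -/

/-- ★★★ **T1 AT TREE LEVEL, UNIFORMLY IN THE LONG EXTENTS.**  For `N ≥ 2`, `k` a unit (`z = ω^k·1`), `n ≥ 1` with `z^n = 1`, and every transverse size
`ℓ₀ = m + 1`: there are `c > 0` and `C ≥ 0`, depending on `N` and `m` ONLY, such that for ALL `L = m₂ + 1` and `t = m₃ + 1` the classical limit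
`D_∞ = lim_{β→∞} projSlabDefect(fund; β, z, n, ℓ₀, L, t)` exists and satisfies `D_∞ ≤ C·L·e^{−ct}` — T1's bound (prefactor linear in `L`: the
one-dimensional multiplicity of the slab's excitations; rate `c` = the twisted transverse tree-level gap) holds at `β = ∞`, uniformly.  Here
`c = min_{p,q₀,q₁} ω⊥_{p,q₀,q₁}` and `C = 4·#{p ≠ 0}·ℓ₀²`. [cite: tHooft1979Flux, §5 (5.1)–(5.4)] [cite: GarciaperezGonzalezarroyoOkawa2014, §3] -/
theorem twistedSlabAnchor_treeLevel_uniform {k : ZMod N} (hN : 2 ≤ N) (hk : IsUnit k) {n : ℕ} (hn : 0 < n)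
    (hzn : (suCenter N k : Matrix.specialUnitaryGroup (Fin N) ℂ) ^ n = 1) (m : ℕ) :
    ∃ c C : ℝ, 0 < c ∧ 0 ≤ C ∧ ∀ m₂ m₃ : ℕ, ∃ D : ℝ,
      Tendsto (fun β : ℝ => projSlabDefect (fundamentalRep (Fin N)) β (suCenter N k : Matrix.specialUnitaryGroup (Fin N) ℂ) n
          (m + 1) (m₂ + 1) (m₃ + 1)) atTop (𝓝 D) ∧
        D ≤ C * ((m₂ + 1 : ℕ) : ℝ) * Real.exp (-(c * ((m₃ + 1 : ℕ) : ℝ))) := by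
  -- a twist-eating pair (for `ladderFreq_pos` and THE NUMBER)
  obtain ⟨⟨A', B', hAB'⟩, -, -⟩ := hasIsolatingTwist_suCenter (N := N) hk
  have hNm : 2 ≤ N * (m + 1) := le_trans hN (Nat.le_mul_of_pos_right N (Nat.succ_pos m))
  -- the transverse frequencies and their minimum
  set ωt : {p : Fin N × Fin N // p ≠ (0, 0)} × (Fin (m + 1) × Fin (m + 1)) → ℝ := fun i =>
    2 * Real.arsinh (Real.sqrt
        ((2 - 2 * Real.cos (-(2 * Real.pi * (k.val : ℝ) / N) * (i.1.1.2 : ℕ) / (m + 1 : ℕ) + cycleAngle (m + 1) i.2.1)) +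
          ((2 - 2 * Real.cos ((2 * Real.pi * (k.val : ℝ) / N) * (i.1.1.1 : ℕ) / (m + 1 : ℕ) + cycleAngle (m + 1) i.2.2)) +
            (2 - 2 * Real.cos (0 + cycleAngle (0 + 1) (0 : Fin (0 + 1)))))) / 2) with hωt
  have hωtpos : ∀ i, 0 < ωt i := fun i => ladderFreq_pos (m₂ := 0) hk hAB' hNm i.1 (i.2.1, i.2.2, 0)
  have hP : Nonempty {p : Fin N × Fin N // p ≠ (0, 0)} := by
    haveI : Nontrivial (Fin N) := Fin.nontrivial_iff_two_le.2 hN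
    obtain ⟨x, hx⟩ := exists_ne (0 : Fin N)
    exact ⟨⟨(x, 0), fun h => hx (congrArg Prod.fst h)⟩⟩
  haveI : Nonempty ({p : Fin N × Fin N // p ≠ (0, 0)} × (Fin (m + 1) × Fin (m + 1))) := inferInstance
  obtain ⟨i₀, -, hi₀⟩ := Finset.exists_min_image Finset.univ ωt Finset.univ_nonempty
  set c : ℝ := ωt i₀ with hc
  refine ⟨c, 4 * (Fintype.card {p : Fin N × Fin N // p ≠ (0, 0)} : ℝ) * ((m + 1 : ℕ) : ℝ) ^ 2, hωtpos i₀, by positivity, fun m₂ m₃ => ?_⟩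
  refine ⟨_, tendsto_projSlabDefect_tanh (m := m) (m₂ := m₂) (m₃ := m₃) hN hk hn hzn hAB', ?_⟩
  -- `1 − ∏ tanh² ≤ Σ (1 − tanh²) ≤ Σ 4e^{−tω} ≤ #modes · 4e^{−tc}`
  set t : ℝ := ((m₃ + 1 : ℕ) : ℝ) with ht
  have ht0 : 0 ≤ t := by positivity
  rw [← Fintype.prod_prod_type']
  refine (Literature.NumberTheory.DiophantineApproximation.HalandUD.one_sub_prod_le_sum _ _ (fun i _ => sq_nonneg _)
    fun i _ => ?_).trans ?_
  · have htanh : ∀ y : ℝ, Real.tanh y ^ 2 ≤ 1 := fun y => by nlinarith [Real.tanh_lt_one y, Real.neg_one_lt_tanh y]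
    exact htanh _
  · -- termwise bound and counting
    have hterm : ∀ i : {p : Fin N × Fin N // p ≠ (0, 0)} × (Fin (m + 1) × Fin (m + 1) × Fin (m₂ + 1)),
        1 - Real.tanh (t * (2 * Real.arsinh (Real.sqrt
          ((2 - 2 * Real.cos (-(2 * Real.pi * (k.val : ℝ) / N) * (i.1.1.2 : ℕ) / (m + 1 : ℕ) + cycleAngle (m + 1) i.2.1)) +
            ((2 - 2 * Real.cos ((2 * Real.pi * (k.val : ℝ) / N) * (i.1.1.1 : ℕ) / (m + 1 : ℕ) + cycleAngle (m + 1) i.2.2.1)) +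
              (2 - 2 * Real.cos (0 + cycleAngle (m₂ + 1) i.2.2.2)))) / 2)) / 2) ^ 2 ≤ 4 * Real.exp (-(c * t)) := by
      intro i
      have hge : c ≤ 2 * Real.arsinh (Real.sqrt
          ((2 - 2 * Real.cos (-(2 * Real.pi * (k.val : ℝ) / N) * (i.1.1.2 : ℕ) / (m + 1 : ℕ) + cycleAngle (m + 1) i.2.1)) +
            ((2 - 2 * Real.cos ((2 * Real.pi * (k.val : ℝ) / N) * (i.1.1.1 : ℕ) / (m + 1 : ℕ) + cycleAngle (m + 1) i.2.2.1)) +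
              (2 - 2 * Real.cos (0 + cycleAngle (m₂ + 1) i.2.2.2)))) / 2) :=
        (hi₀ (i.1, (i.2.1, i.2.2.1)) (Finset.mem_univ _)).trans (ladderFreq_ge_transverse k i.1 i.2.1 i.2.2.1 i.2.2.2)
      have hy : 0 ≤ t * (2 * Real.arsinh (Real.sqrt
          ((2 - 2 * Real.cos (-(2 * Real.pi * (k.val : ℝ) / N) * (i.1.1.2 : ℕ) / (m + 1 : ℕ) + cycleAngle (m + 1) i.2.1)) +
            ((2 - 2 * Real.cos ((2 * Real.pi * (k.val : ℝ) / N) * (i.1.1.1 : ℕ) / (m + 1 : ℕ) + cycleAngle (m + 1) i.2.2.1)) +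
              (2 - 2 * Real.cos (0 + cycleAngle (m₂ + 1) i.2.2.2)))) / 2)) / 2 :=
        div_nonneg (mul_nonneg ht0 ((hωtpos i₀).le.trans (by rw [hc] at hge; exact hge))) zero_le_two
      refine (one_sub_tanh_sq_le hy).trans (mul_le_mul_of_nonneg_left (Real.exp_le_exp.2 (neg_le_neg ?_)) (by norm_num))
      calc c * t ≤ (2 * Real.arsinh (Real.sqrt
          ((2 - 2 * Real.cos (-(2 * Real.pi * (k.val : ℝ) / N) * (i.1.1.2 : ℕ) / (m + 1 : ℕ) + cycleAngle (m + 1) i.2.1)) +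
            ((2 - 2 * Real.cos ((2 * Real.pi * (k.val : ℝ) / N) * (i.1.1.1 : ℕ) / (m + 1 : ℕ) + cycleAngle (m + 1) i.2.2.1)) +
              (2 - 2 * Real.cos (0 + cycleAngle (m₂ + 1) i.2.2.2)))) / 2)) * t := mul_le_mul_of_nonneg_right hge ht0
        _ = 2 * (t * (2 * Real.arsinh (Real.sqrt
          ((2 - 2 * Real.cos (-(2 * Real.pi * (k.val : ℝ) / N) * (i.1.1.2 : ℕ) / (m + 1 : ℕ) + cycleAngle (m + 1) i.2.1)) +
            ((2 - 2 * Real.cos ((2 * Real.pi * (k.val : ℝ) / N) * (i.1.1.1 : ℕ) / (m + 1 : ℕ) + cycleAngle (m + 1) i.2.2.1)) +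
              (2 - 2 * Real.cos (0 + cycleAngle (m₂ + 1) i.2.2.2)))) / 2)) / 2) := by ring
    refine (Finset.sum_le_sum fun i _ => hterm i).trans ?_
    rw [Finset.sum_const, Finset.card_univ, nsmul_eq_mul]
    simp only [Fintype.card_prod, Fintype.card_fin]
    push_cast
    apply le_of_eq
    ring

end Summit.QuantumFields.YangMills.Cruxes.IRcof.TwistedSlab

end
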